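import Summits.QuantumFields.YangMills.Theorems.BalabanUVNodesN15PerCubeGreenSopInverse
import Summits.QuantumFields.YangMills.Theorems.BalabanUVNodesN15PerCubeGreenInstance
import HarnessLib

/-!
# N15 = NE2, road (c) — PROGRAMME (PC), (PC-B): `(Q′G′²Q′ᵀ)⁻¹(U)` FOR `U` IN THE CLASS (3.35) ON THE WALK-LOCALITY BOXES — the consumer-facing reading of n15-c∕299e with r06's
# `Reg335Cube` BY NAME, and its NON-VACUITY at every pure gauge (dag-n15-c g28, n15-c∕299f)

Cell `pub-ymgap`, seat `pub-ymgap-dag-n15-c` (generation g28; R134 (a), s1; HUMAN RULING D-0062).  `bears_on: R4∕N15 · K3⁸ SpineGivenEndpointR13SepCoPHV (stmt-QuantumFields-27366)`;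
filed `--kind proof --supports stmt-QuantumFields-27366 --as helper` — COUNT-NEUTRAL.  0 `def`, 0 `sorry`.  Imports n15-c∕299e `…PerCubeGreenSopInverse` (★★★★ `hasMaj_cSop_inv_of_reg335BigBox`),
n15-c∕267 `…PerCubeGreenInstance` (`sigma_le_of_small`; through it r06 `Reg335Cube`, `uN_mem_unitaryGroup_of_norm_le_one`, FILE 119 `blockOf_shift_mem_cubeBlocks`).  Nothing in the tree is modified.

WHY.  n15-c∕299e asks, on the walk-locality box `B_□ = {x | B(x) ∈ c(m_B, □) + [0, S_B)}` of every cube (`m_B = Lw + 3w − 1 − m₀`, `S_B = (L+10)w`), for a gauge `u_□` UNITARY EVERYWHERE with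
`U^{u_□} = e^{iηA_□}` and the (3.35) bounds on `B_□`.  Bałaban's class (3.35) ([B9] p.396: «there exists a gauge transformation u on □ such that U^u = e^{iηA} …») gives `u` of unitary type ON THE
BOX only; ★★★★ `hasMaj_cSop_inv_of_reg335Box10` takes r06's `Reg335Cube` on the box ONE COLLAR LARGER, `B⁺_□ = {x | B(x) ∈ c(m_B + 1, □) + [0, S_B + 2)}`, extends the class's gauge by `1`
off `B⁺_□` (unitary everywhere), and reads `U^u = e^{iηA}` on `B_□` (both ends of every bond of `B_□` lie in `B⁺_□`, FILE 119).  ★★★ `hasMaj_cSop_inv_pureGauge`: every pure gauge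
`U = (v(x)v(x + e_μ)⁻¹)`, `v` unitary, satisfies ALL hypotheses (gauge `v⁻¹`, `A = 0`, letters `r_V` and `σ(r_V)` below `R₀` for a class constant `C(r_V) > 0`, n15-c∕267's arithmetic) — so
`(Q′G′²Q′ᵀ)⁻¹` of a pure gauge decays with the constants of 299e, uniformly in `k` (A6: the ★★★★ theorem is inhabited by non-constant `U(m)` fields).

HONEST FRAMING ∕ LIMITS.  MODEL carriers (n15-c∕262's cover of the doubled unit torus, `L ≥ 11`; boxes of side `(L+10)w + 2` in the torus `2Lw`); no operator of record estimated; [B9] cited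
for SHAPES ∕ MECHANISM.  NE2⁺ NOT PRINTED, NOT proved; N15 of record untouched; K3⁸ OPEN; counts UNMOVED.  Restate-immune (no Theses import).
-/

noncomputable section

open scoped BigOperators Matrix Matrix.Norms.L2Operator

namespace Summit.QuantumFields.YangMills.BalabanUVNodes.N15.Gluing

open Real
open Literature.MathematicalPhysics.QuantumFieldTheory.Balaban1983to89
open Literature.MathematicalPhysics.QuantumFieldTheory.Balaban1983to89.B5Prop11Plancherel (Tor fine unitVec)
open Literature.MathematicalPhysics.QuantumFieldTheory.Balaban1983to89.B11SectG (BlockNorm HasMaj)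
open Literature.MathematicalPhysics.QuantumFieldTheory.Balaban1983to89.B6UnitTorusCarrier (unitTorusGeo)
open Literature.MathematicalPhysics.QuantumFieldTheory.Balaban1983to89.B9Eq335RegularityClasses (Reg335Cube)
open Literature.MathematicalPhysics.QuantumFieldTheory.Balaban1983to89.B9Eq3117Current (gaugeTr gaugeTr_apply)
open Literature.MathematicalPhysics.QuantumFieldTheory.Balaban1983to89.B9Eq39Adjoint (covD fluct covD_zero)
open Literature.MathematicalPhysics.QuantumFieldTheory.Balaban1983to89.B9BackgroundsKLevelV1 (fluct_zero)
open Summit.QuantumFields.YangMills.BalabanUVNodes.N15.CovLandau (cSop)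
open Literature.MathematicalPhysics.QuantumFieldTheory.King1986 (aK)
open Literature.MathematicalPhysics.QuantumFieldTheory.King1986.Torus (blockOf)
open Literature.Barriers.QuantumFields (traceForm)
open Summit.QuantumFields.YangMills.BalabanUVNodes.N15.MatrixSpecies (basisConst basisConst_nonneg liftBlk)
open Summit.QuantumFields.YangMills.BalabanUVNodes.N15.TwoGrid (cubeBlocks)
open Summit.QuantumFields.YangMills.BalabanUVNodes.N15.CurvedSpecies (uN_mem_unitaryGroup_of_norm_le_one uN_val_inv_eq_conjTranspose)

variable {d : ℕ}

section Class

variable {L : ℕ} [NeZero L]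

/-- ★★★★ **`(Q′G′²Q′ᵀ)⁻¹(U)` DECAYS FOR `U` IN r06's CLASS (3.35) ON THE BOX `B⁺_□` OF EVERY CUBE** (n15-c∕299e read with `Reg335Cube` by name): for all `m, k ≥ 1` with `L^m ≥ w₀`,
every isometric chart, every `U(m)` field with `Reg335Cube (· + e_μ) U L^{−k} {x | B(x) ∈ c(Lw + 3w − m₀, □) + [0, (L+10)w + 2)} ξ C` for every cube `□`, and letters `r_V`, `σ(r_V)` below
`R₀`: `mulVecLin (cSop (cvT e U) a_K)⁻¹ ≤ B·(L^k)^{d+1}·e^{−δ|y−y′|_T}`.  MODEL carriers; the SHAPE ∕ MECHANISM of [B9] (3.95)–(3.96) with the class asked on boxes, NOT the printed statement.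
[cite: Balaban1985BackgroundPropagators, (3.35) p.396, (3.95)–(3.96) p.411, Cor. 3.8 p.410 (shapes ∕ mechanism); Balaban1984PropagatorsI, (1.20) p.20] -/
theorem hasMaj_cSop_inv_of_reg335Box10 (hL : Odd L ∧ 1 < L) (hL11 : 11 ≤ L) {a₀ : ℝ} (ha₀ : 0 < a₀) (ι : Type) [Fintype ι] [DecidableEq ι] :
    ∃ δ w₀ R₀ B : ℝ, 0 < δ ∧ 0 < R₀ ∧ 0 < B ∧
      ∀ (mv kk : ℕ), 1 ≤ kk → w₀ ≤ ((L ^ mv : ℕ) : ℝ) →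
      ∀ {mm : Type} [Fintype mm] [DecidableEq mm] [Nonempty mm] (e : Matrix mm mm ℂ ≃L[ℝ] (ι → ℝ)), (∀ A B : Matrix mm mm ℂ, traceForm A B = e A ⬝ᵥ e B) →
      ∀ (U : Fin (d + 1) → ScX d L mv kk hL → (Matrix mm mm ℂ)ˣ), (∀ μ x, (U μ x : Matrix mm mm ℂ) ∈ Matrix.unitaryGroup mm ℂ) →
      ∀ (ξ C : ℝ), 0 < ξ → 0 < C →
        (∀ k : Fin (d + 1) → ZMod (2 * L), Reg335Cube (scShift d L mv kk hL) U ((((L ^ kk : ℕ) : ℝ))⁻¹)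
          {x : ScX d L mv kk hL | blockOf (L ^ kk) (cvM d L mv kk hL) x ∈ cubeBlocks (cvM d L mv kk hL) (coverCorner (cvM d L mv kk hL) (L ^ mv) L (L * L ^ mv + 3 * L ^ mv - 1 - coverMargin L mv + 1) k) (L * L ^ mv + 10 * L ^ mv + 2)} ξ C) →
      ∀ (rV : ℝ), 0 ≤ rV →
        Fintype.card ι * (@basisConst ι _ (Matrix mm mm ℂ) Matrix.frobeniusNormedAddCommGroup Matrix.frobeniusNormedSpace e * (2 * Real.sqrt (Fintype.card mm)) * (Real.sqrt (Fintype.card mm) * ((C / ξ) * Real.exp (((((L ^ kk : ℕ) : ℝ))⁻¹) * (C / ξ))))) ≤ rV →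
        Fintype.card ι * (Fintype.card (Fin (d + 1)) * (Fintype.card ι * (@basisConst ι _ (Matrix mm mm ℂ) Matrix.frobeniusNormedAddCommGroup Matrix.frobeniusNormedSpace e * (2 * Real.sqrt (Fintype.card mm)) * (Real.sqrt (Fintype.card mm) * ((C / ξ) * Real.exp (((((L ^ kk : ℕ) : ℝ))⁻¹) * (C / ξ))))) ^ 2 + @basisConst ι _ (Matrix mm mm ℂ) Matrix.frobeniusNormedAddCommGroup Matrix.frobeniusNormedSpace e * (2 * Real.sqrt (Fintype.card mm)) * (Real.sqrt (Fintype.card mm) * ((C / ξ ^ 2) * Real.exp (((((L ^ kk : ℕ) : ℝ))⁻¹) * (C / ξ)))))) ≤ rV →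
        rV * (1 + Fintype.card (Fin (d + 1) ⊕ Fin (d + 1))) + a₀ * (Fintype.card ι * (Fintype.card ι * ((1 + rV * ((((L ^ kk : ℕ) : ℝ))⁻¹)) ^ ((d + 1) * L ^ kk) - 1) ^ 2 + 2 * ((1 + rV * ((((L ^ kk : ℕ) : ℝ))⁻¹)) ^ ((d + 1) * L ^ kk) - 1))) ≤ R₀ →
        ((1 + rV * ((((L ^ kk : ℕ) : ℝ))⁻¹)) ^ ((d + 1) * L ^ kk) - 1) ≤ R₀ →
        HasMaj (BlockNorm.ofBlocks (unitTorusGeo L kk (cvM d L mv kk hL)) (liftBlk (fun y : Tor (cvM d L mv kk hL) => y) ι)) (BlockNorm.ofBlocks (unitTorusGeo L kk (cvM d L mv kk hL)) (liftBlk (fun y : Tor (cvM d L mv kk hL) => y) ι))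
            (Matrix.mulVecLin (cSop (cvM d L mv kk hL) (L ^ kk) (cvT e (fun μ x => (U μ x : Matrix mm mm ℂ))) (aK a₀ (L : ℝ) kk * (((L ^ kk : ℕ) : ℝ)) ^ (d + 1)))⁻¹)
          (fun y y' => B * (((L ^ kk : ℕ) : ℝ)) ^ (d + 1) * Real.exp (-(δ * (unitTorusGeo L kk (cvM d L mv kk hL)).dist y y'))) := by
  classical
  obtain ⟨δ, w₀, R₀, B, hδ, hR₀, hB, H⟩ := hasMaj_cSop_inv_of_reg335BigBox (d := d) hL hL11 ha₀ ι
  refine ⟨δ, max w₀ 2, R₀, B, hδ, hR₀, hB, fun mv kk hk hw₀ => ?_⟩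
  intro mm _ _ _ e he U hU ξ C hξ hC hclass rV hrV hrA hrC hRle hσV
  have hw₀' : w₀ ≤ ((L ^ mv : ℕ) : ℝ) := (le_max_left _ _).trans hw₀
  have hW2 : 2 ≤ L ^ mv := by have h := (le_max_right w₀ 2).trans hw₀; exact_mod_cast h
  have hM : ∀ ν, cvM d L mv kk hL ν = 2 * L * L ^ mv := MP_succ_eq L mv kk hL
  refine H mv kk hk hw₀' e he U hU ξ C hξ hC (fun k => ?_) rV hrV hrA hrC hRle hσV
  obtain ⟨u, A, hu1, hg, hA, hD⟩ := hclass k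
  -- the class's gauge is unitary on the box; extend it by `1`
  set Q : Set (ScX d L mv kk hL) := {x : ScX d L mv kk hL | blockOf (L ^ kk) (cvM d L mv kk hL) x ∈ cubeBlocks (cvM d L mv kk hL) (coverCorner (cvM d L mv kk hL) (L ^ mv) L (L * L ^ mv + 3 * L ^ mv - 1 - coverMargin L mv + 1) k) (L * L ^ mv + 10 * L ^ mv + 2)} with hQ
  have huQ : ∀ z ∈ Q, (u z : Matrix mm mm ℂ) ∈ Matrix.unitaryGroup mm ℂ := fun z hz => uN_mem_unitaryGroup_of_norm_le_one (u z) (hu1 z hz).1 (hu1 z hz).2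
  set u' : ScX d L mv kk hL → (Matrix mm mm ℂ)ˣ := fun z => if z ∈ Q then u z else 1 with hu'
  have hu'U : ∀ z, (u' z : Matrix mm mm ℂ) ∈ Matrix.unitaryGroup mm ℂ := fun z => by
    by_cases hz : z ∈ Q
    · simp only [hu', if_pos hz]; exact huQ z hz
    · simp only [hu', if_neg hz, Units.val_one]; exact Submonoid.one_mem _
  -- both ends of every bond of the box lie in the larger box (FILE 119)
  have hstep : ∀ z : ScX d L mv kk hL, blockOf (L ^ kk) (cvM d L mv kk hL) z ∈ cubeBlocks (cvM d L mv kk hL) (coverCorner (cvM d L mv kk hL) (L ^ mv) L (L * L ^ mv + 3 * L ^ mv - 1 - coverMargin L mv) k) (L * L ^ mv + 10 * L ^ mv) →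
      ∀ μ, z ∈ Q ∧ scShift d L mv kk hL μ z ∈ Q := fun z hz μ => by
    have h10 : 10 * L ^ mv + 2 ≤ L * L ^ mv := by
      have : 11 * L ^ mv ≤ L * L ^ mv := Nat.mul_le_mul_right _ hL11
      omega
    have hS : L * L ^ mv + 10 * L ^ mv + 2 ≤ 2 * L * L ^ mv := by
      have e2 : 2 * L * L ^ mv = 2 * (L * L ^ mv) := by ring
      rw [e2]; omega
    have key := blockOf_shift_mem_cubeBlocks (m₁ := L * L ^ mv + 3 * L ^ mv - 1 - coverMargin L mv) (m₀ := L * L ^ mv + 3 * L ^ mv - 1 - coverMargin L mv + 1)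
      (S₁ := L * L ^ mv + 10 * L ^ mv) (S₀ := L * L ^ mv + 10 * L ^ mv + 2) hM (by omega) (by omega) hS hz μ
    exact ⟨key.1, key.2.1⟩
  refine ⟨u', A, hu'U, fun μ z hz => ?_, fun μ z hz => hA μ z (hstep z hz μ).1, fun μ ν z hz => hD μ ν z (hstep z hz μ).1⟩
  obtain ⟨h0, h1⟩ := hstep z hz μ
  have e0 : u' z = u z := by simp only [hu', if_pos h0]
  have e1 : u' (scShift d L mv kk hL μ z) = u (scShift d L mv kk hL μ z) := by simp only [hu', if_pos h1]
  rw [gaugeTr_apply, e0, e1, ← gaugeTr_apply]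
  exact hg μ z h0

/-- ★★★ **NON-VACUITY (A6): `(Q′G′²Q′ᵀ)⁻¹` OF EVERY PURE GAUGE DECAYS WITH 299e's CONSTANTS** — for `U = (v(x)v(x + e_μ)⁻¹)`, `v` unitary, the hypotheses of `hasMaj_cSop_inv_of_reg335BigBox`
hold with the gauge `v⁻¹`, the potential `A = 0` and a class constant `C(r_V) > 0` making the letters `r_V`, `σ(r_V)` as small as required (n15-c∕267's arithmetic); so the ★★★★ theorem
is inhabited by genuinely non-constant `U(m)` fields. [cite: Balaban1985BackgroundPropagators, (3.35) p.396, (3.28) p.395, (3.95)–(3.96) p.411 (shapes)] -/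
theorem hasMaj_cSop_inv_pureGauge (hL : Odd L ∧ 1 < L) (hL11 : 11 ≤ L) {a₀ : ℝ} (ha₀ : 0 < a₀) (ι : Type) [Fintype ι] [DecidableEq ι] :
    ∃ δ w₀ B : ℝ, 0 < δ ∧ 0 < B ∧
      ∀ (mv kk : ℕ), 1 ≤ kk → w₀ ≤ ((L ^ mv : ℕ) : ℝ) →
      ∀ {mm : Type} [Fintype mm] [DecidableEq mm] [Nonempty mm] (e : Matrix mm mm ℂ ≃L[ℝ] (ι → ℝ)), (∀ A B : Matrix mm mm ℂ, traceForm A B = e A ⬝ᵥ e B) →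
      ∀ (v : ScX d L mv kk hL → (Matrix mm mm ℂ)ˣ), (∀ x, (v x : Matrix mm mm ℂ) ∈ Matrix.unitaryGroup mm ℂ) →
        HasMaj (BlockNorm.ofBlocks (unitTorusGeo L kk (cvM d L mv kk hL)) (liftBlk (fun y : Tor (cvM d L mv kk hL) => y) ι)) (BlockNorm.ofBlocks (unitTorusGeo L kk (cvM d L mv kk hL)) (liftBlk (fun y : Tor (cvM d L mv kk hL) => y) ι))
            (Matrix.mulVecLin (cSop (cvM d L mv kk hL) (L ^ kk) (cvT e (fun μ x => (gaugeTr (scShift d L mv kk hL) v (fun (_ : Fin (d + 1)) (_ : ScX d L mv kk hL) => (1 : (Matrix mm mm ℂ)ˣ)) μ x : Matrix mm mm ℂ))) (aK a₀ (L : ℝ) kk * (((L ^ kk : ℕ) : ℝ)) ^ (d + 1)))⁻¹)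
          (fun y y' => B * (((L ^ kk : ℕ) : ℝ)) ^ (d + 1) * Real.exp (-(δ * (unitTorusGeo L kk (cvM d L mv kk hL)).dist y y'))) := by
  obtain ⟨δ, w₀, R₀, B, hδ, hR₀, hB, H⟩ := hasMaj_cSop_inv_of_reg335BigBox (d := d) hL hL11 ha₀ ι
  refine ⟨δ, w₀, B, hδ, hB, fun mv kk hk hw₀ => ?_⟩
  intro mm _ _ _ e he v hv
  have hnr : (0 : ℝ) < ((L ^ kk : ℕ) : ℝ) := by exact_mod_cast pow_pos (Nat.pos_of_ne_zero (NeZero.ne L)) kk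
  have hn1 : (1 : ℝ) ≤ ((L ^ kk : ℕ) : ℝ) := by exact_mod_cast Nat.one_le_pow _ _ (Nat.pos_of_ne_zero (NeZero.ne L))
  have hη1 : ((((L ^ kk : ℕ) : ℝ))⁻¹) ≤ 1 := inv_le_one_of_one_le₀ hn1
  -- the smallness letter `r_V` (n15-c∕267's choice, shrunk so that `σ ≤ R₀` too)
  set K : ℝ := (1 + Fintype.card (Fin (d + 1) ⊕ Fin (d + 1))) + a₀ * (Fintype.card ι * ((Fintype.card ι + 2) * (2 * ((d : ℝ) + 1)))) + 2 * ((d : ℝ) + 1) + 1 with hK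
  have hK0 : 0 < K := by positivity
  set rV : ℝ := min (1 / (2 * ((d : ℝ) + 1))) (R₀ / K) with hrV
  have hrV0 : 0 < rV := lt_min (by positivity) (by positivity)
  have hrV1 : 2 * ((d : ℝ) + 1) * rV ≤ 1 := by
    have h := min_le_left (1 / (2 * ((d : ℝ) + 1))) (R₀ / K)
    rw [← hrV] at h
    calc 2 * ((d : ℝ) + 1) * rV ≤ 2 * ((d : ℝ) + 1) * (1 / (2 * ((d : ℝ) + 1))) := mul_le_mul_of_nonneg_left h (by positivity)
      _ = 1 := by field_simp
  have hrVK : rV * K ≤ R₀ := by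
    have h := min_le_right (1 / (2 * ((d : ℝ) + 1))) (R₀ / K)
    rw [← hrV] at h
    calc rV * K ≤ R₀ / K * K := mul_le_mul_of_nonneg_right h hK0.le
      _ = R₀ := by field_simp
  obtain ⟨hσ0, hσle, hσ1⟩ := sigma_le_of_small d (L ^ kk) (pow_pos (Nat.pos_of_ne_zero (NeZero.ne L)) kk) hrV0.le hrV1
  -- the class constant `C`
  set g : ℝ := @basisConst ι _ (Matrix mm mm ℂ) Matrix.frobeniusNormedAddCommGroup Matrix.frobeniusNormedSpace e * (2 * Real.sqrt (Fintype.card mm)) with hg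
  have hg0 : 0 ≤ g := by have := @basisConst_nonneg ι _ (Matrix mm mm ℂ) Matrix.frobeniusNormedAddCommGroup Matrix.frobeniusNormedSpace e; positivity
  set Q : ℝ := g * (Real.sqrt (Fintype.card mm) * 3) with hQ
  have hQ0 : 0 ≤ Q := by positivity
  set P₁ : ℝ := Fintype.card ι * Q with hP₁
  set P₂ : ℝ := Fintype.card ι * (Fintype.card (Fin (d + 1)) * (Fintype.card ι * Q ^ 2 + Q)) with hP₂
  have hP₁0 : 0 ≤ P₁ := by positivity
  have hP₂0 : 0 ≤ P₂ := by positivity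
  set C : ℝ := min 1 (rV / (P₁ + P₂ + 1)) with hC
  have hC0 : 0 < C := lt_min one_pos (by positivity)
  have hC1 : C ≤ 1 := min_le_left _ _
  have hCr : C * (P₁ + P₂ + 1) ≤ rV := by
    have h := min_le_right 1 (rV / (P₁ + P₂ + 1))
    rw [← hC] at h
    calc C * (P₁ + P₂ + 1) ≤ rV / (P₁ + P₂ + 1) * (P₁ + P₂ + 1) := mul_le_mul_of_nonneg_right h (by positivity)
      _ = rV := by field_simp
  have hE : Real.exp (((((L ^ kk : ℕ) : ℝ))⁻¹) * (C / 1)) ≤ 3 := by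
    rw [div_one]
    have h1 : ((((L ^ kk : ℕ) : ℝ))⁻¹) * C ≤ 1 := mul_le_one₀ hη1 hC0.le hC1
    calc Real.exp (((((L ^ kk : ℕ) : ℝ))⁻¹) * C) ≤ Real.exp 1 := Real.exp_le_exp.mpr h1
      _ ≤ 3 := by have := Real.exp_one_lt_d9; linarith
  have hY : g * (Real.sqrt (Fintype.card mm) * ((C / 1) * Real.exp (((((L ^ kk : ℕ) : ℝ))⁻¹) * (C / 1)))) ≤ Q * C := by
    have : (C / 1) * Real.exp (((((L ^ kk : ℕ) : ℝ))⁻¹) * (C / 1)) ≤ 3 * C := by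
      rw [mul_comm]; rw [div_one] at hE ⊢; exact mul_le_mul_of_nonneg_right hE hC0.le
    calc g * (Real.sqrt (Fintype.card mm) * ((C / 1) * Real.exp (((((L ^ kk : ℕ) : ℝ))⁻¹) * (C / 1)))) ≤ g * (Real.sqrt (Fintype.card mm) * (3 * C)) := by gcongr
      _ = Q * C := by rw [hQ]; ring
  have hY0 : 0 ≤ g * (Real.sqrt (Fintype.card mm) * ((C / 1) * Real.exp (((((L ^ kk : ℕ) : ℝ))⁻¹) * (C / 1)))) := by positivity
  have hY2 : g * (Real.sqrt (Fintype.card mm) * ((C / 1 ^ 2) * Real.exp (((((L ^ kk : ℕ) : ℝ))⁻¹) * (C / 1)))) ≤ Q * C := by rw [one_pow]; exact hY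
  have hrA : Fintype.card ι * (g * (Real.sqrt (Fintype.card mm) * ((C / 1) * Real.exp (((((L ^ kk : ℕ) : ℝ))⁻¹) * (C / 1))))) ≤ rV := by
    calc Fintype.card ι * (g * (Real.sqrt (Fintype.card mm) * ((C / 1) * Real.exp (((((L ^ kk : ℕ) : ℝ))⁻¹) * (C / 1))))) ≤ Fintype.card ι * (Q * C) := by gcongr
      _ = P₁ * C := by rw [hP₁]; ring
      _ ≤ rV := by have := mul_nonneg hC0.le hP₂0; linarith
  have hrC : Fintype.card ι * (Fintype.card (Fin (d + 1)) * (Fintype.card ι * (g * (Real.sqrt (Fintype.card mm) * ((C / 1) * Real.exp (((((L ^ kk : ℕ) : ℝ))⁻¹) * (C / 1))))) ^ 2 +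
      g * (Real.sqrt (Fintype.card mm) * ((C / 1 ^ 2) * Real.exp (((((L ^ kk : ℕ) : ℝ))⁻¹) * (C / 1)))))) ≤ rV := by
    have h1 : (g * (Real.sqrt (Fintype.card mm) * ((C / 1) * Real.exp (((((L ^ kk : ℕ) : ℝ))⁻¹) * (C / 1))))) ^ 2 ≤ Q ^ 2 * C := by
      calc (g * (Real.sqrt (Fintype.card mm) * ((C / 1) * Real.exp (((((L ^ kk : ℕ) : ℝ))⁻¹) * (C / 1))))) ^ 2 ≤ (Q * C) ^ 2 := pow_le_pow_left₀ hY0 hY 2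
        _ = Q ^ 2 * (C * C) := by ring
        _ ≤ Q ^ 2 * C := mul_le_mul_of_nonneg_left (mul_le_of_le_one_left hC0.le hC1) (by positivity)
    calc Fintype.card ι * (Fintype.card (Fin (d + 1)) * (Fintype.card ι * (g * (Real.sqrt (Fintype.card mm) * ((C / 1) * Real.exp (((((L ^ kk : ℕ) : ℝ))⁻¹) * (C / 1))))) ^ 2 +
          g * (Real.sqrt (Fintype.card mm) * ((C / 1 ^ 2) * Real.exp (((((L ^ kk : ℕ) : ℝ))⁻¹) * (C / 1))))))
        ≤ Fintype.card ι * (Fintype.card (Fin (d + 1)) * (Fintype.card ι * (Q ^ 2 * C) + Q * C)) := by gcongr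
      _ = P₂ * C := by rw [hP₂]; ring
      _ ≤ rV := by have := mul_nonneg hC0.le hP₁0; linarith
  have hRle : rV * (1 + Fintype.card (Fin (d + 1) ⊕ Fin (d + 1))) + a₀ * (Fintype.card ι * (Fintype.card ι * ((1 + rV * ((((L ^ kk : ℕ) : ℝ))⁻¹)) ^ ((d + 1) * L ^ kk) - 1) ^ 2 +
      2 * ((1 + rV * ((((L ^ kk : ℕ) : ℝ))⁻¹)) ^ ((d + 1) * L ^ kk) - 1))) ≤ R₀ := by
    set σ : ℝ := (1 + rV * ((((L ^ kk : ℕ) : ℝ))⁻¹)) ^ ((d + 1) * L ^ kk) - 1 with hσ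
    have hσ2 : σ ^ 2 ≤ σ := by
      calc σ ^ 2 = σ * σ := sq σ
        _ ≤ 1 * σ := mul_le_mul_of_nonneg_right hσ1 hσ0
        _ = σ := one_mul σ
    have h1 : Fintype.card ι * σ ^ 2 + 2 * σ ≤ (Fintype.card ι + 2) * (2 * (((d : ℝ) + 1) * rV)) := by
      calc Fintype.card ι * σ ^ 2 + 2 * σ ≤ Fintype.card ι * σ + 2 * σ := by gcongr
        _ = (Fintype.card ι + 2) * σ := by ring
        _ ≤ (Fintype.card ι + 2) * (2 * (((d : ℝ) + 1) * rV)) := mul_le_mul_of_nonneg_left hσle (by positivity)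
    calc rV * (1 + Fintype.card (Fin (d + 1) ⊕ Fin (d + 1))) + a₀ * (Fintype.card ι * (Fintype.card ι * σ ^ 2 + 2 * σ))
        ≤ rV * (1 + Fintype.card (Fin (d + 1) ⊕ Fin (d + 1))) + a₀ * (Fintype.card ι * ((Fintype.card ι + 2) * (2 * (((d : ℝ) + 1) * rV)))) := by gcongr
      _ = rV * ((1 + Fintype.card (Fin (d + 1) ⊕ Fin (d + 1))) + a₀ * (Fintype.card ι * ((Fintype.card ι + 2) * (2 * ((d : ℝ) + 1))))) := by ring
      _ ≤ rV * K := mul_le_mul_of_nonneg_left (by rw [hK]; linarith [show (0 : ℝ) ≤ 2 * ((d : ℝ) + 1) by positivity]) hrV0.le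
      _ ≤ R₀ := hrVK
  have hσV : (1 + rV * ((((L ^ kk : ℕ) : ℝ))⁻¹)) ^ ((d + 1) * L ^ kk) - 1 ≤ R₀ := by
    calc (1 + rV * ((((L ^ kk : ℕ) : ℝ))⁻¹)) ^ ((d + 1) * L ^ kk) - 1 ≤ 2 * (((d : ℝ) + 1) * rV) := hσle
      _ = rV * (2 * ((d : ℝ) + 1)) := by ring
      _ ≤ rV * K := mul_le_mul_of_nonneg_left (by rw [hK]; linarith [show (0 : ℝ) ≤ a₀ * (Fintype.card ι * ((Fintype.card ι + 2) * (2 * ((d : ℝ) + 1)))) by positivity, show (0 : ℝ) ≤ 1 + Fintype.card (Fin (d + 1) ⊕ Fin (d + 1)) by positivity]) hrV0.le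
      _ ≤ R₀ := hrVK
  -- the gauge data: `u = v⁻¹`, `A = 0`
  have hU : ∀ μ x, (gaugeTr (scShift d L mv kk hL) v (fun (_ : Fin (d + 1)) (_ : ScX d L mv kk hL) => (1 : (Matrix mm mm ℂ)ˣ)) μ x : Matrix mm mm ℂ) ∈ Matrix.unitaryGroup mm ℂ := fun μ x => by
    rw [gaugeTr_apply, Units.val_mul, Units.val_mul, Units.val_one, mul_one, uN_val_inv_eq_conjTranspose (hv _)]
    exact Submonoid.mul_mem _ (hv x) (Unitary.star_mem (hv _))
  have hbig : ∀ k : Fin (d + 1) → ZMod (2 * L), ∃ (u : ScX d L mv kk hL → (Matrix mm mm ℂ)ˣ) (A : Fin (d + 1) → ScX d L mv kk hL → Matrix mm mm ℂ),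
      (∀ x, (u x : Matrix mm mm ℂ) ∈ Matrix.unitaryGroup mm ℂ) ∧
      (∀ μ, ∀ z ∈ {x : ScX d L mv kk hL | blockOf (L ^ kk) (cvM d L mv kk hL) x ∈ cubeBlocks (cvM d L mv kk hL) (coverCorner (cvM d L mv kk hL) (L ^ mv) L (L * L ^ mv + 3 * L ^ mv - 1 - coverMargin L mv) k) (L * L ^ mv + 10 * L ^ mv)},
          gaugeTr (scShift d L mv kk hL) u (gaugeTr (scShift d L mv kk hL) v (fun (_ : Fin (d + 1)) (_ : ScX d L mv kk hL) => (1 : (Matrix mm mm ℂ)ˣ))) μ z = fluct ((((L ^ kk : ℕ) : ℝ))⁻¹) A μ z) ∧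
      (∀ μ, ∀ z ∈ {x : ScX d L mv kk hL | blockOf (L ^ kk) (cvM d L mv kk hL) x ∈ cubeBlocks (cvM d L mv kk hL) (coverCorner (cvM d L mv kk hL) (L ^ mv) L (L * L ^ mv + 3 * L ^ mv - 1 - coverMargin L mv) k) (L * L ^ mv + 10 * L ^ mv)},
          ‖A μ z‖ < C * (1 : ℝ)⁻¹) ∧
      (∀ μ ν, ∀ z ∈ {x : ScX d L mv kk hL | blockOf (L ^ kk) (cvM d L mv kk hL) x ∈ cubeBlocks (cvM d L mv kk hL) (coverCorner (cvM d L mv kk hL) (L ^ mv) L (L * L ^ mv + 3 * L ^ mv - 1 - coverMargin L mv) k) (L * L ^ mv + 10 * L ^ mv)},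
          ‖((↑((((L ^ kk : ℕ) : ℝ))⁻¹) : ℂ)⁻¹) • covD (scShift d L mv kk hL) (fun _ _ => (1 : (Matrix mm mm ℂ)ˣ)) μ (A ν) z‖ < C * ((1 : ℝ) ^ 2)⁻¹) := fun k => by
    refine ⟨fun x => (v x)⁻¹, 0, fun x => ?_, fun μ z _ => ?_, fun μ z _ => ?_, fun μ ν z _ => ?_⟩
    · rw [uN_val_inv_eq_conjTranspose (hv x)]; exact Unitary.star_mem (hv x)
    · rw [fluct_zero]
      ext1
      simp only [gaugeTr_apply, Units.val_mul, Units.val_one, mul_one, inv_inv, Units.inv_mul_cancel_left, Units.inv_mul]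
    · rw [Pi.zero_apply, Pi.zero_apply, norm_zero, inv_one, mul_one]; exact hC0
    · rw [Pi.zero_apply, covD_zero, smul_zero, norm_zero, one_pow, inv_one, mul_one]; exact hC0
  rw [hg] at hrA hrC
  exact H mv kk hk hw₀ e he (gaugeTr (scShift d L mv kk hL) v (fun (_ : Fin (d + 1)) (_ : ScX d L mv kk hL) => (1 : (Matrix mm mm ℂ)ˣ))) hU 1 C one_pos hC0 hbig rV hrV0.le hrA hrC hRle hσV

end Class

end Summit.QuantumFields.YangMills.BalabanUVNodes.N15.Gluing

end
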